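import Literature.MathematicalPhysics.QuantumFieldTheory.Balaban1983to89.Node00.TorusCoverGaugeTokensGuardedB

/-!
# BalabanUVNodes ∕ K0 ROAD — THE `4 ≤ F.m` BRANCH OF plan g75's V14 STUB 3 `K0ROfStepTokensRAt F`, COMPOSED: the ⁶ ∕ ⁷ K0 bodies for `F` at `N = 2` from EXACTLY
# [15] Proposition 8's top step (`Prop8RegSepTopStep`, N07), [6] Proposition 6 at NODE 00's ℤᵈ cube member (`B8.Prop6Printed … (zdCub …)`, N05), the β-box of
# `betaOfRecord₁₃ F 2 θ₁₅ᶜᶜᴹ(3)` and the signs — at the collared witness `M = M₁ = L³`, floor `c = (11·4 + 3·L)·L`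

SIBLING MODULE (director-ym №365, R558 FINAL «RENAME-AND-REDIRECT»): this is the NEW module `K0ROfStepTokensRCubeB` (namespace `Summit.QuantumFields.YangMills.Theorems.K0ROfStepTokensRCubeB`), carrying the
Stage-2 re-keyed texts of `K0ROfStepTokensRCube` under the SAME short declaration names (every FQN new ⇒ `theorems.append-only` untouched); the old module `K0ROfStepTokensRCube` is NOT edited and becomes
RESIDUE after the seam (R556 attic later); GREEN ON BOTH SIDES OF THE SEAM (director-ym №368 (2)): this sibling carries only the SEAM-FREE content of the residue module — the cube-letter arithmetic and the (9)-cube tokens (S1b-1 over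
`(Adm, bd, Dat)`); the two `4 ≤ F.m`-bounded V15 closers `exists_k0{R,H}_of_prop8TopStep_of_prop6Member_of_betaBox` are NOT carried (they read chain B's re-typed `_cube` closer; superseded by the
all-torus forms of `…K0AllTorusOfStepTokensRCubeB` §1–§2 over `…K0AllTorusOfStepTokensRFloorB`; consumers = residue only).  The two arithmetic helpers `shrunkCeiling_pos` ∕ `mul_shrunkCeiling_le` are GENERALISED to any gauge-group rank `N` (the old module states them at `N = 2`) so that no
landed statement is restated (`dedup.landed`).

STAGE-2 RE-KEY (seat `pub-ymgap-k0-s1-w3` g9, TRAIN-K0 row K0-T2 file 1∕6; director-ym №343 (D5) ∕ №346 ∕ №354; k0-s1-w1 g9 MANIFEST): (E1) Stage-2 coherence re-key to print's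
(2.3) datum (FLAG №16 ∕ LOCATE-HSEAM 5d3298b8d191f169); the (b)-keyed text survives in git history.  Every displayed [15] token of this file is now the GUARDED `(bd, Dat)` ᴮ token at
the cube floor guard `floorGuard F ((11·4 + 3·L)·L)` (print's «R₁M₁ sufficiently big», p.304 lines 1–2, at the collar letter of the cube witness `M = L³`), print's bond datum `lamDatum F`
([14] (2.3): `lamBondsSeq Ω k`) and the (7)-data predicate of record `dataSmall7PTopOf F 2` — the currency of node00-def-T's Stage-2 chain B (`Record13SepCoPInhabitedOfThm1CCMGaugeR`'s
`_cube` closer): Prop. 8's top step `Prop8RegSepTopStepGB F 2 suppDom (floorGuard F ((11·4+3·L)·L)) (lamDatum F) (dataSmall7PTopOf F 2) B₃ a₀ a₁` (`Node00/CriticalOnFibreTopGuardedB`), (8)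
`VariationalThm1RegSepCoP7MGB …` (`Record12BgRowCoClassCPMFloorB`; from the step by k0-s1-w1's 53′ `variationalThm1RegSepCoP7MGB_of_prop8TopStepGB_lamDatum`), the (9)-step `Gauge9RegSepTopStepGB …`
(`TorusCoverGaugeTokensGuardedB`; from Prop. 8 ∧ [6] Prop. 6 by `gauge9GB_of_prop8TopStepGB_of_gauge152R_of_imp` ∘ `gauge152R_of_prop6`).  Declaration NAMES and binder ORDER unchanged
(the `R` in them is historical); ONE additive sibling `gauge9GB_cube_of_prop8TopStepGB_of_prop6Member` (guard ∕ datum ∕ data GENERIC, conclusion at `Adm ∧ floor`) for consumers holding the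
step token at another guard (N24 doors, the grid guard `A‴`).  Re-keying bookkeeping only — nothing of Bałaban asserted.  [14] = [Balaban1984PropagatorsII].

Cell `pub-ymgap`, seat `pub-ymgap-dag-n21-c` (g11), pens (γ)+(β) of dag-lead WORDS-144∕145; FILE C (Summits side because dag-n07-e's bridge `variationalThm1RegSepCoP7M_of_prop8TopStep`
lives here).  Consumed BY NAME: dag-n07-e FILE 29 `Node00.TorusCoverGaugeTokensR` (`gauge152R_of_prop6`, `b9Of`, `a0Of`, `a0Of_pos`) and S1b-1
`Node00.TorusCoverGaugeTokensGuardedB` (`gauge9GB_of_prop8TopStepGB_of_gauge152R` ∕ `…_of_imp`, `Prop8RegSepTopStepGB.of_le`) — the ONLY import.  `--kind proof --supports stmt-QuantumFields-20541 --as helper`.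
[15] = [Balaban1985Variational]; [6] = [Balaban1985RegularSpaces]; [III] = [Balaban1988Convergent]; [I] = [Balaban1987RG1]; [IV] = [Balaban1989LargeFieldI].

WHAT THIS FILE PROVES (theorems only).  `shrunkCeiling_pos` ∕ `mul_shrunkCeiling_le` (the shrunk ceiling `a₁' = min a₁ (a₀(9)∕B₃)` is positive and `B₃·a₁' ≤ a₀(9)`, any rank `N`);
★★ `gauge9GB_cube_of_prop8TopStepGB_of_prop6Member` — [6] Prop. 6 at the member ⇒ `Gauge152OfClassTopStepR … M ((44+3L)L) (b9Of) (a0Of)` (FILE 29) ⇒ with [15] Prop. 8's guarded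
top step (shrunk to `a₁'`) the (9)-step token `Gauge9RegSepTopStepGB F 2 suppDom M (fun ν … => Adm ν … ∧ (44+3L)L ≤ ν.M₁) bd Dat B₃ (B₉·B₃) a₀ a₁'` (S1b-1
`gauge9GB_of_prop8TopStepGB_of_gauge152R_of_imp`), guard ∕ datum ∕ data GENERIC; ★★ `gauge9R_cube_of_prop8TopStep_of_prop6Member` — its instance at the cube letter
`(floorGuard F ((11·4+3·L)·L), lamDatum F, dataSmall7PTopOf F 2)`, `M = L³` (print's (9) constant `B₃' = B₉·B₃`).  The residue's two `4 ≤ F.m`-bounded V15 closers are NOT here (see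
SIBLING MODULE above).

HONEST FRAMING.  A composition of tree theorems; CONDITIONAL on [15] Prop. 8's top step (N07's node), [6] Prop. 6 at the member (N05's node), the β-box at the collared witness and
the signs — all DISPLAYED hypotheses, never asserted; the `F.m ≤ 3` families are NOT covered (plan g75 LOCATED (δ)); nothing of Bałaban asserted or discharged; K0⁷ NOT closed;
counts unmoved (typed 28∕28 · discharged 5∕27); one finite 𝕋⁴ programme at fixed ε — NOT continuum ∕ OS ∕ mass gap ∕ Clay.  No `sorry`, `def`, `instance`, `notation`.
-/

noncomputable section

open scoped Matrix.Norms.L2Operator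

namespace Summit.QuantumFields.YangMills.Theorems.K0ROfStepTokensRCubeB

open Literature.MathematicalPhysics.QuantumFieldTheory.Balaban1983to89
open Literature.MathematicalPhysics.QuantumFieldTheory.Balaban1983to89.T4Continuum
open Literature.MathematicalPhysics.QuantumFieldTheory.Balaban1983to89.Node00
open Literature.MathematicalPhysics.QuantumFieldTheory.Balaban1983to89.FlowStep

variable (F : T4Family)

/-- **THE SHRUNK CEILING IS POSITIVE** (any gauge-group rank `N`): `0 < min a₁ (a0Of F N M B₁ c₁ ∕ B₃)` for `0 < a₁`, `0 ≤ B₁`, `0 < c₁`, `0 < B₃`. [cite: Balaban1985Variational, (152) p.301 («9dL²Mε₀ ≦ c₁»; bookkeeping)] -/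
theorem shrunkCeiling_pos {N : ℕ} [NeZero N] (M : ℕ) {B₃ B₁ c₁ a₁ : ℝ} (hB₃ : 0 < B₃) (hB₁ : 0 ≤ B₁) (hc₁ : 0 < c₁) (ha₁ : 0 < a₁) :
    0 < min a₁ (a0Of F N M B₁ c₁ / B₃) :=
  lt_min ha₁ (div_pos (a0Of_pos (F := F) (N := N) M hB₁ hc₁) hB₃)

/-- **THE SHRUNK CEILING MEETS THE BRIDGE'S SMALLNESS** (any `N`): `B₃ · min a₁ (a₀''∕B₃) ≤ a₀''`. [cite: Balaban1985Variational, (152) p.301, Thm 1 p.279 («B₃ε₁ ≤ ε₀»; bookkeeping)] -/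
theorem mul_shrunkCeiling_le {N : ℕ} [NeZero N] (M : ℕ) {B₃ B₁ c₁ a₁ : ℝ} (hB₃ : 0 < B₃) :
    B₃ * min a₁ (a0Of F N M B₁ c₁ / B₃) ≤ a0Of F N M B₁ c₁ :=
  calc B₃ * min a₁ (a0Of F N M B₁ c₁ / B₃) ≤ B₃ * (a0Of F N M B₁ c₁ / B₃) := mul_le_mul_of_nonneg_left (min_le_right _ _) hB₃.le
    _ = a0Of F N M B₁ c₁ := mul_div_cancel₀ _ hB₃.ne'

/-- **★ THE GUARDED (9)-STEP OVER `(bd, Dat)` AT ANY CUBE LETTER `M` WITH THE COLLAR FLOOR, FROM THE TWO PRINTED INPUTS, ANY GUARD** (additive sibling, Stage 2): [15] Prop. 8's top step over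
`(Adm, bd, Dat)` at `(B₃, a₀, a₁)` and [6] Prop. 6 at NODE 00's member give S1b-1's `Gauge9RegSepTopStepGB F 2 suppDom M (Adm ∧ (11·4+3L)·L ≤ ν.M₁) bd Dat B₃ (b9Of(M)·B₃) a₀ (min a₁ (a0Of(M)∕B₃))`
(`gauge152R_of_prop6` ∘ `gauge9GB_of_prop8TopStepGB_of_gauge152R`, Prop. 8 shrunk by `.of_le`).  CONDITIONAL on both inputs; nothing of Bałaban asserted.
[cite: Balaban1985Variational, Thm 1 (8)–(9) p.279, Sect. F pp.300–305, (152) p.301, Prop. 8 p.304, p.304 lines 1–2; Balaban1985RegularSpaces, Prop. 6 p.99, (1.3)–(1.6) p.77; Balaban1984PropagatorsII, (2.3) p.224] -/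
theorem gauge9GB_cube_of_prop8TopStepGB_of_prop6Member {Adm : StepGuard F} {bd : BondDatum F} {Dat : TopData F 2} {B₃ a₀ a₁ B₁ c₁ : ℝ} (hB₃ : 0 < B₃)
    (h8 : Prop8RegSepTopStepGB F 2 (fun ν K Ω => suppDomOfRecord F ν K Ω) Adm bd Dat B₃ a₀ a₁) (hB₁ : 0 ≤ B₁) (hc₁ : 0 < c₁)
    (hP6 : letI : CStarAlgebra (MatA 2) := {}; B8.Prop6Printed 4 (F.L : ℝ) B₁ c₁ (fun i : B8LeafModelZd.ZdIdx 4 F.L => zdCub (MatA 2) F.L i)) (M : ℕ) :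
    Gauge9RegSepTopStepGB F 2 (fun ν K Ω => suppDomOfRecord F ν K Ω) M (fun ν M' g K k s => Adm ν M' g K k s ∧ (11 * 4 + 3 * F.L) * F.L ≤ ν.M₁) bd Dat B₃
      (b9Of F M B₁ * B₃) a₀ (min a₁ (a0Of F 2 M B₁ c₁ / B₃)) :=
  gauge9GB_of_prop8TopStepGB_of_gauge152R (h8.of_le le_rfl (min_le_left _ _)) (gauge152R_of_prop6 hB₁ hc₁ hP6 M) hB₃ (mul_shrunkCeiling_le F M hB₃)

/-- **★ THE GUARDED (9)-STEP AT THE COLLARED CUBE LETTER FROM THE TWO PRINTED INPUTS** (Stage-2 edition of dag-n21-c's R cube token; NAME kept): [15] Prop. 8's top step at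
`(B₃, a₀, a₁)` under the cube floor guard `floorGuard F ((11·4+3L)·L)` over print's datum `lamDatum F` and the (7)-data of record, and [6] Prop. 6 at NODE 00's member, give S1b-1's
`Gauge9RegSepTopStepGB F 2 suppDom (L³) (floorGuard F ((11·4+3L)·L)) (lamDatum F) (dataSmall7PTopOf F 2) B₃ (b9Of·B₃) a₀ (min a₁ (a0Of∕B₃))` — the `h9` of chain B's `_cube` closers
(`gauge9GB_of_prop8TopStepGB_of_gauge152R_of_imp`, the floor implication is the guard itself).  CONDITIONAL on both inputs.
[cite: Balaban1985Variational, Thm 1 (8)–(9) p.279, Sect. F pp.300–305, (152) p.301, Prop. 8 p.304, p.304 lines 1–2; Balaban1985RegularSpaces, Prop. 6 p.99, (1.3)–(1.6) p.77; Balaban1984PropagatorsII, (2.3) p.224] -/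
theorem gauge9R_cube_of_prop8TopStep_of_prop6Member {B₃ a₀ a₁ B₁ c₁ : ℝ} (hB₃ : 0 < B₃)
    (h8 : Prop8RegSepTopStepGB F 2 (fun ν K Ω => suppDomOfRecord F ν K Ω) (floorGuard F ((11 * 4 + 3 * F.L) * F.L)) (lamDatum F) (dataSmall7PTopOf F 2) B₃ a₀ a₁)
    (hB₁ : 0 ≤ B₁) (hc₁ : 0 < c₁)
    (hP6 : letI : CStarAlgebra (MatA 2) := {}; B8.Prop6Printed 4 (F.L : ℝ) B₁ c₁ (fun i : B8LeafModelZd.ZdIdx 4 F.L => zdCub (MatA 2) F.L i)) :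
    Gauge9RegSepTopStepGB F 2 (fun ν K Ω => suppDomOfRecord F ν K Ω) (F.L ^ 3) (floorGuard F ((11 * 4 + 3 * F.L) * F.L)) (lamDatum F) (dataSmall7PTopOf F 2) B₃
      (b9Of F (F.L ^ 3) B₁ * B₃) a₀ (min a₁ (a0Of F 2 (F.L ^ 3) B₁ c₁ / B₃)) :=
  gauge9GB_of_prop8TopStepGB_of_gauge152R_of_imp (h8.of_le le_rfl (min_le_left _ _)) (gauge152R_of_prop6 hB₁ hc₁ hP6 (F.L ^ 3)) hB₃
    (mul_shrunkCeiling_le F (F.L ^ 3) hB₃) (fun _ _ _ _ _ _ h => h)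

end Summit.QuantumFields.YangMills.Theorems.K0ROfStepTokensRCubeB

end
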